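import Mathlib
import Literature.Geometry.Lorentzian.KerrConvergence
import Literature.Geometry.Lorentzian.ImmersionChartMetric
import Literature.Geometry.Lorentzian.LeviCivitaProofs
import Literature.Geometry.Lorentzian.Causality
import Literature.Geometry.Lorentzian.CauchyDevelopment
import Literature.Geometry.Lorentzian.KerrSchild
import Literature.Geometry.Lorentzian.BoundedGeometry
import Summits.FinalStateConjecture.FinalStateConjecture.Theorems.PhotonSphereChannelsTameCensorshipPancakeLawTail
import Summits.FinalStateConjecture.FinalStateConjecture.Theorems.PhotonSphereChannelsTameCensorshipNormalChart
import Summits.FinalStateConjecture.FinalStateConjecture.Theorems.PhotonSphereChannelsTameCensorshipPinnedBall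
import Summits.FinalStateConjecture.FinalStateConjecture.Theorems.PhotonSphereChannelsTameCensorshipLocalFrameBound

/-!
# Route PhotonSphereChannels · crux `TameCensorship` (stmt-FinalStateConjecture-17431) · line `Sketch`, skeleton v6 ·
# THE PANCAKE LAW, VERBATIM — tail form + the compact initial segment

Closing file of the pancake law (lead c2, 2026-08-17; `--supports stmt-FinalStateConjecture-17431`, registered as
`stub_pancakeLaw`). The tail form (`stub_pancakeLawTail`, `…PancakeLawTail.lean`) gives the u-coupled weight table of
a visible future-incomplete null geodesic from some parameter `t₁` on; on the compact initial segment `γ([0, t₁])` a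
null frame adapted to `γ'` with curvature components bounded by ONE constant exists at every point
(`initialSegment_frameBound`: a normalised chart at each point, `stub_normalChart_exists`, pinned with derivative bounds on
a ball, `stub_pinnedBall_of_normalChart`, a local frame bound along `γ`, `stub_localFrameBound`, a finite subcover of the
segment), and the two tables merge with `u := 1` on the segment and `C := max (max C_tail B) (max (sSup dom − t₁)⁻¹ 1)`.
The statement is the def-free unfolding of the sibling line's `PancakeLaw` (clause (ii) of K3 for a development ⇒ every
visible future-incomplete null geodesic has a tame END).

References: B. O'Neill, *Semi-Riemannian Geometry* (1983), Ch. 2, Lemma 24; Ch. 3, Prop. 3.59; Ch. 5, Lemma 8, Lemma 26;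
Ch. 14, Lemma 13, Lemma 29.
-/

set_option linter.dupNamespace false
set_option maxSynthPendingDepth 3

open Literature.Geometry.Lorentzian
open scoped Manifold ContDiff Topology
open Set Filter TopologicalSpace

noncomputable section

namespace Summit.FinalStateConjecture.FinalStateConjecture.Theorems.PhotonSphereChannels.TameCensorshipUnwind

/-! ## The initial segment and the verbatim pancake law -/

/-- **Uniform frame bound on a compact parameter segment of a null geodesic.** For a geodesic `γ` of a spacetime with
null velocity on an open order-connected `dom` and `a ≤ b` in `dom`, there is ONE constant `B` such that at every
`γ t`, `t ∈ [a, b]`, some null frame adapted to `γ' t` has all curvature components `≤ B` (normalised charts at each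
point, `stub_normalChart_exists`, pinned on small balls, `stub_pinnedBall_of_normalChart`, local frame bounds along `γ`,
`stub_localFrameBound`, and a finite subcover of `[a, b]`). [folklore; O'Neill 1983, Ch. 5, Lemma 26] -/
theorem initialSegment_frameBound (𝓢 : Spacetime.{0} 4) [𝓢.metric.HasLeviCivita] (γ : ℝ → 𝓢.carrier)
    (dom : Set ℝ) (hdo : IsOpen dom) (hdc : dom.OrdConnected) (hgeo : IsGeodesicOn 𝓢.metric.leviCivita γ dom)
    (hnull : ∀ t ∈ dom, 𝓢.metric.IsNull (velocity (𝓡 4) γ t)) {a b : ℝ} (ha : a ∈ dom) (hb : b ∈ dom) :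
    ∃ B : ℝ, ∀ t ∈ Icc a b, ∃ f : Fin 4 → TangentSpace (𝓡 4) (γ t),
      (f 0 = velocity (𝓡 4) γ t ∧ 𝓢.metric.val (γ t) (f 0) (f 0) = 0 ∧ 𝓢.metric.val (γ t) (f 1) (f 1) = 0 ∧
          𝓢.metric.val (γ t) (f 0) (f 1) = -1 ∧
          𝓢.metric.val (γ t) (f 2) (f 2) = 1 ∧ 𝓢.metric.val (γ t) (f 3) (f 3) = 1 ∧
          𝓢.metric.val (γ t) (f 2) (f 3) = 0 ∧
          𝓢.metric.val (γ t) (f 0) (f 2) = 0 ∧ 𝓢.metric.val (γ t) (f 0) (f 3) = 0 ∧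
          𝓢.metric.val (γ t) (f 1) (f 2) = 0 ∧ 𝓢.metric.val (γ t) (f 1) (f 3) = 0) ∧
        ∀ i j k l : Fin 4,
          |𝓢.metric.val (γ t) (CovariantDerivative.curvature 𝓢.metric.leviCivita (γ t) (f i) (f j) (f k)) (f l)| ≤
            B := by
  -- local data at every parameter of the segment
  have hloc : ∀ s ∈ Icc a b, ∃ ε : ℝ, 0 < ε ∧ ∃ B : ℝ, ∀ t ∈ dom, |t - s| < ε →
      ∃ f : Fin 4 → TangentSpace (𝓡 4) (γ t),
        (f 0 = velocity (𝓡 4) γ t ∧ 𝓢.metric.val (γ t) (f 0) (f 0) = 0 ∧ 𝓢.metric.val (γ t) (f 1) (f 1) = 0 ∧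
            𝓢.metric.val (γ t) (f 0) (f 1) = -1 ∧
            𝓢.metric.val (γ t) (f 2) (f 2) = 1 ∧ 𝓢.metric.val (γ t) (f 3) (f 3) = 1 ∧
            𝓢.metric.val (γ t) (f 2) (f 3) = 0 ∧
            𝓢.metric.val (γ t) (f 0) (f 2) = 0 ∧ 𝓢.metric.val (γ t) (f 0) (f 3) = 0 ∧
            𝓢.metric.val (γ t) (f 1) (f 2) = 0 ∧ 𝓢.metric.val (γ t) (f 1) (f 3) = 0) ∧
          ∀ i j k l : Fin 4,
            |𝓢.metric.val (γ t) (CovariantDerivative.curvature 𝓢.metric.leviCivita (γ t) (f i) (f j) (f k)) (f l)| ≤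
              B := by
    intro s hs
    have hsdom : s ∈ dom := hdc.out ha hb hs
    obtain ⟨O, h0, Ψ, hΨ, hΨ', hinj, hemb, hΨ0, hη⟩ := stub_normalChart_exists 𝓢 (γ s)
    obtain ⟨ρ, hρ, hball, L, hbounds⟩ := stub_pinnedBall_of_normalChart 𝓢 O h0 Ψ hΨ hΨ' hη
    exact stub_localFrameBound 𝓢 O h0 Ψ hΨ hΨ' ρ L hinj hemb hρ hball hbounds γ dom s hdo hgeo hnull hsdom hΨ0
  choose! ε hε Bl hBl using hloc
  -- finite subcover of the compact segment
  have hcover : Icc a b ⊆ ⋃ s ∈ Icc a b, Metric.ball s (ε s) := fun t ht ↦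
    mem_iUnion₂.2 ⟨t, ht, Metric.mem_ball_self (hε t ht)⟩
  obtain ⟨T, hTsub, hTfin, hTcov⟩ := (isCompact_Icc (a := a) (b := b)).elim_finite_subcover_image
    (fun s _ ↦ Metric.isOpen_ball) hcover
  refine ⟨∑ s ∈ hTfin.toFinset, |Bl s|, fun t ht ↦ ?_⟩
  obtain ⟨s, hsT, hts⟩ := mem_iUnion₂.1 (hTcov ht)
  have hs : s ∈ Icc a b := hTsub hsT
  have htdom : t ∈ dom := hdc.out ha hb ht
  have hts' : |t - s| < ε s := by
    rw [Metric.mem_ball, Real.dist_eq] at hts; exact hts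
  obtain ⟨f, hframe, hR⟩ := hBl s hs t htdom hts'
  refine ⟨f, hframe, fun i j k l ↦ (hR i j k l).trans ?_⟩
  calc Bl s ≤ |Bl s| := le_abs_self _
    _ ≤ ∑ s' ∈ hTfin.toFinset, |Bl s'| :=
        Finset.single_le_sum (f := fun s' ↦ |Bl s'|) (fun _ _ ↦ abs_nonneg _) (hTfin.mem_toFinset.2 hsT)

set_option maxHeartbeats 800000 in
/-- **THE PANCAKE LAW (verbatim, def-free statement)**: in a Cauchy development whose outer region is covered by uniformly
tame late charts (clause (ii) of K3 for this development), every visible future-incomplete null geodesic has a TAME END: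
the u-coupled weight table at EVERY `t ≥ 0` of `dom` — the tail form `stub_pancakeLawTail` merged with the uniform frame
bound on the compact initial segment (`initialSegment_frameBound`, with `u := 1` there and
`C := max (max C_tail B) (max (sSup dom − t₁)⁻¹ 1)`). -/
theorem stub_pancakeLaw :
    ∀ (X : Type) [TopologicalSpace X] [ChartedSpace E3 X] [IsManifold (𝓡 3) ∞ X] [T2Space X]
    [SecondCountableTopology X] [ConnectedSpace X],
    ∀ (D : InitialDataSet (𝓡 3) X) (𝒟 : CauchyDevelopment D), ∀ [𝒟.metric.HasLeviCivita],
    (∀ [𝒟.metric.HasLeviCivita],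
      ∃ r₀ : ℝ, 0 < r₀ ∧ ∃ Λ : NNReal, ∀ q ∈ 𝒟.metric.causalFuture 𝒟.timeOrientation (Set.range 𝒟.embed) ∩
          {q | ∃ (p : X) (γ : ℝ → 𝒟.carrier) (dom : Set ℝ),
            𝒟.metric.IsNormalisedNullRayFrom 𝒟.timeOrientation 𝒟.embed 𝒟.normal p γ dom ∧
              ¬ BddAbove dom ∧
                q ∈ 𝒟.metric.chronologicalPast 𝒟.timeOrientation (γ '' (dom ∩ Set.Ici 0))},
        ∃ Ψ : (⟨Metric.ball (0 : E4) r₀, Metric.isOpen_ball⟩ : TopologicalSpace.Opens E4) → 𝒟.carrier,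
          𝒟.toSpacetime.IsLateChart
              (Minkowski.backgroundOn (⟨Metric.ball (0 : E4) r₀, Metric.isOpen_ball⟩ : TopologicalSpace.Opens E4))
              Set.univ (-r₀) Ψ ∧
            (∃ x : (⟨Metric.ball (0 : E4) r₀, Metric.isOpen_ball⟩ : TopologicalSpace.Opens E4),
                (x : E4) = 0 ∧ Ψ x = q) ∧
              supCkENorm (((⟨Metric.ball (0 : E4) r₀, Metric.isOpen_ball⟩ : TopologicalSpace.Opens E4)) : Set E4) 3
                  (𝒟.toSpacetime.deviationExtend
                    (Minkowski.backgroundOn (⟨Metric.ball (0 : E4) r₀, Metric.isOpen_ball⟩ : TopologicalSpace.Opens E4))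
                    Ψ) ≤ (Λ : ENNReal) ∧
                supCkENorm (((⟨Metric.ball (0 : E4) r₀, Metric.isOpen_ball⟩ : TopologicalSpace.Opens E4)) : Set E4) 0
                  (𝒟.toSpacetime.deviationExtend
                    (Minkowski.backgroundOn (⟨Metric.ball (0 : E4) r₀, Metric.isOpen_ball⟩ : TopologicalSpace.Opens E4))
                    Ψ) ≤ 1 / 2) →
    ∀ (γ : ℝ → 𝒟.carrier) (dom : Set ℝ),
    (IsMaximalGeodesicOn 𝒟.metric.leviCivita γ dom ∧ (0 : ℝ) ∈ dom ∧ BddAbove dom ∧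
      (∀ t ∈ dom, 𝒟.metric.IsNull (velocity (𝓡 4) γ t) ∧
        𝒟.timeOrientation.IsFutureDirected (velocity (𝓡 4) γ t)) ∧
      (∀ t ∈ dom, 0 ≤ t → (∃ (p : X) (δ : ℝ → 𝒟.carrier) (s : Set ℝ),
        𝒟.metric.IsNormalisedNullRayFrom 𝒟.timeOrientation 𝒟.embed 𝒟.normal p δ s ∧
          ¬ BddAbove s ∧
            γ t ∈ 𝒟.metric.chronologicalPast 𝒟.timeOrientation (δ '' (s ∩ Set.Ici 0))))) →
    ∃ C : ℝ, 0 < C ∧ ∀ t ∈ dom, 0 ≤ t →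
      ∃ f : Fin 4 → TangentSpace (𝓡 4) (γ t),
        (f 0 = velocity (𝓡 4) γ t ∧ 𝒟.metric.val (γ t) (f 0) (f 0) = 0 ∧ 𝒟.metric.val (γ t) (f 1) (f 1) = 0 ∧
          𝒟.metric.val (γ t) (f 0) (f 1) = -1 ∧
          𝒟.metric.val (γ t) (f 2) (f 2) = 1 ∧ 𝒟.metric.val (γ t) (f 3) (f 3) = 1 ∧
          𝒟.metric.val (γ t) (f 2) (f 3) = 0 ∧
          𝒟.metric.val (γ t) (f 0) (f 2) = 0 ∧ 𝒟.metric.val (γ t) (f 0) (f 3) = 0 ∧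
          𝒟.metric.val (γ t) (f 1) (f 2) = 0 ∧ 𝒟.metric.val (γ t) (f 1) (f 3) = 0) ∧
        ∃ u : ℝ, (C * (sSup dom - t))⁻¹ ≤ u ∧
          ∀ a b c d : Fin 4,
            |𝒟.metric.val (γ t)
                (CovariantDerivative.curvature 𝒟.metric.leviCivita (γ t) (f a) (f b) (f c)) (f d)| ≤
              C * u ^ ((if a = 0 then 1 else if a = 1 then -1 else 0 : ℤ) +
                (if b = 0 then 1 else if b = 1 then -1 else 0 : ℤ) +
                (if c = 0 then 1 else if c = 1 then -1 else 0 : ℤ) +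
                (if d = 0 then 1 else if d = 1 then -1 else 0 : ℤ)) := by
  intro X _ _ _ _ _ _ D 𝒟 _ hT γ dom hvis
  obtain ⟨t₁, ht₁dom, Ct, hCt, htail⟩ := stub_pancakeLawTail X D 𝒟 hT γ dom hvis
  obtain ⟨hmax, h0, hbdd, hnull, -⟩ := hvis
  have hopen : IsOpen dom := hmax.isOpen
  have hord : dom.OrdConnected := hmax.2.1
  have hgeo : IsGeodesicOn 𝒟.metric.leviCivita γ dom := hmax.isGeodesicOn
  -- the initial segment `[0, t₁']`, `t₁' = max t₁ 0`
  set t₁' : ℝ := max t₁ 0 with ht₁'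
  have ht₁'dom : t₁' ∈ dom := by
    rcases le_total t₁ 0 with h | h
    · rw [ht₁', max_eq_right h]; exact h0
    · rw [ht₁', max_eq_left h]; exact ht₁dom
  obtain ⟨B, hB⟩ := initialSegment_frameBound 𝒟.toSpacetime γ dom hopen hord hgeo (fun t ht ↦ (hnull t ht).1)
    h0 ht₁'dom
  -- the end of the domain
  have hlt : ∀ t ∈ dom, t < sSup dom := by
    intro t ht
    obtain ⟨δ, hδ, hsub⟩ := Metric.isOpen_iff.1 hopen t ht
    have h1 : t + δ / 2 ∈ dom := hsub (by
      rw [Metric.mem_ball, Real.dist_eq, add_sub_cancel_left, abs_of_pos (half_pos hδ)]; exact half_lt_self hδ)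
    have h2 := le_csSup hbdd h1
    linarith
  have hb₁ : 0 < sSup dom - t₁' := by linarith [hlt t₁' ht₁'dom]
  -- the constant
  set C : ℝ := max (max Ct B) (max (sSup dom - t₁')⁻¹ 1) with hC
  have hC1 : 1 ≤ C := (le_max_right _ _).trans (le_max_right _ _)
  have hCpos : 0 < C := lt_of_lt_of_le one_pos hC1
  have hCt_le : Ct ≤ C := (le_max_left _ _).trans (le_max_left _ _)
  have hB_le : B ≤ C := (le_max_right _ _).trans (le_max_left _ _)
  have hinv_le : (sSup dom - t₁')⁻¹ ≤ C := (le_max_left _ _).trans (le_max_right _ _)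
  refine ⟨C, hCpos, fun t ht h0t ↦ ?_⟩
  have hbt : 0 < sSup dom - t := by linarith [hlt t ht]
  rcases le_or_gt t₁' t with hle | hgt
  · -- the tail
    obtain ⟨f, hframe, u, hu, htab⟩ := htail t ht ((le_max_left _ _).trans hle)
    have hupos : 0 < u := lt_of_lt_of_le (by positivity) hu
    refine ⟨f, hframe, u, le_trans ?_ hu, fun a b c d ↦ (htab a b c d).trans ?_⟩
    · exact inv_anti₀ (by positivity) (mul_le_mul_of_nonneg_right hCt_le hbt.le)
    · exact mul_le_mul_of_nonneg_right hCt_le (zpow_pos hupos _).le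
  · -- the initial segment, `u := 1`
    obtain ⟨f, hframe, hR⟩ := hB t ⟨h0t, hgt.le⟩
    refine ⟨f, hframe, 1, ?_, fun a b c d ↦ ?_⟩
    · rw [← inv_one]
      refine inv_anti₀ one_pos ?_
      have h1 : sSup dom - t₁' ≤ sSup dom - t := by linarith
      calc (1 : ℝ) = (sSup dom - t₁')⁻¹ * (sSup dom - t₁') := by field_simp
        _ ≤ C * (sSup dom - t) := mul_le_mul hinv_le h1 hb₁.le hCpos.le
    · rw [one_zpow, mul_one]
      exact (hR a b c d).trans hB_le

end Summit.FinalStateConjecture.FinalStateConjecture.Theorems.PhotonSphereChannels.TameCensorshipUnwind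

end
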